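import Summits.HubbardSuperconductivity.HubbardSuperconductivity.Theorems.ThermalWedgeTwSeededEnsembleEquivalenceBarrierSectorBound
import Summits.HubbardSuperconductivity.HubbardSuperconductivity.Theorems.ThermalWedgeTwSeededEnsembleEquivalenceBarrierGap

/-!
# Crux `TwSeededEnsembleEquivalence` (stmt-HubbardSuperconductivity-1698), line `exposed-density-duality` —
# STRUCTURAL BARRIER 3/3: the thermally NARROWED crux shape (`β ≤ e^{a/U}`) fails too (registered stub `stub_notCruxNarrowShapeAtomicSWave`)

Complement to `…BarrierGap` (2/2). The standing disprover's recommended narrowing `CruxNarrow` caps `β ≤ e^{a/U}` (for every `a`,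
with `U₀ = U₀(δ,a)`). For the atomic s-wave-seeded torus of the structural counterexample this cap does NOT help: the canonical hull
gap `(g/100)L²` is temperature-independent while the allowance `log 4/β` at `β = 560 log 4/U ≤ (100/U)²/2 ≤ e^{100/U}` is `g/400`.
Here: the gap at explicit parameters (`gap_at_of_sectorBound`: `0 < g ≤ 1/10`, `U = 7g/5`, every `μ`, every `L ≥ 10`) and
`stub_notCruxNarrowShapeAtomicSWave`: the sector lower bound (landed `stub_barrierSectorLowerBound`) implies that the `CruxNarrow`-shaped
statement written for `hubbardTorus 2 L 0 U` / `pairField sWave L` is FALSE. Reading for the planner: in the structural class only the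
seed floor `g ≥ K·U` (which excludes `U/(2g) ∈ (1/2,1)`) removes the counterexample; restate with BOTH `β ≤ e^{a/U}` and `g ≥ K·U`
(= what `twSeededRung_structural` consumes). No definitions; everything is proved.
-/

set_option linter.dupNamespace false

namespace Summit.HubbardSuperconductivity.HubbardSuperconductivity.Theorems.TwSeededEnsembleEquivalence.ExposedDensity

open Matrix Finset Literature.MathematicalPhysics.QuantumLattice Literature.Probability.LatticeModels
open scoped ComplexOrder Matrix.Norms.L2Operator
open StructuralBarrier

noncomputable section

/-- **The gap at explicit parameters**: for `0 < g ≤ 1/10`, `U = 7g/5`, every slope `μ` and every `L ≥ 10`,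
`E₀(HsCan − μN̂) + (g/100)L² ≤ minEnergyOn(HsCan, szSector N_L 0) − μN_L` at density `7/10` (same proof as the gap theorem,
with the seed strength kept explicit so that the thermally narrowed shape can be refuted too). [folklore] -/
theorem gap_at_of_sectorBound
    (hSB : (∀ (L : ℕ) [NeZero L] (U g : ℝ) (N : ℕ) (M : ℝ), 0 ≤ g →
      min 0 (U * N / 2 - g / (L : ℝ) ^ 2 * N * ((L : ℝ) ^ 2 - N / 2 + 1)) ≤
        (hubbardTorus 2 L 0 U - ((g / (L : ℝ) ^ 2 : ℝ) : ℂ) •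
          ((pairField sWave L)ᴴ * pairField sWave L)).minEnergyOn (szSector (Λ := FermionTorus 2 L) N M)))
    {g : ℝ} (hg0 : 0 < g) (hg10 : g ≤ 1 / 10) (μ : ℝ) (L : ℕ) [NeZero L] (hL : 10 ≤ L) :
    (hubbardTorusWith 2 L 0 (7 / 5 * g) μ - ((g / (L : ℝ) ^ 2 : ℝ) : ℂ) •
      ((pairField sWave L)ᴴ * pairField sWave L)).groundEnergy + g / 100 * (L : ℝ) ^ 2 ≤
    (hubbardTorus 2 L 0 (7 / 5 * g) - ((g / (L : ℝ) ^ 2 : ℝ) : ℂ) •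
      ((pairField sWave L)ᴴ * pairField sWave L)).minEnergyOn
        (szSector (Λ := FermionTorus 2 L) (2 * ⌊(1 - 3 / 10) * (L : ℝ) ^ 2 / 2⌋₊) 0) -
      μ * ((2 * ⌊(1 - 3 / 10) * (L : ℝ) ^ 2 / 2⌋₊ : ℕ) : ℝ) := by
  -- sizes
  have hL : (10 : ℝ) ≤ L := by exact_mod_cast hL
  have hL2 : (100 : ℝ) ≤ (L : ℝ) ^ 2 := by nlinarith
  have hLpos : (0 : ℝ) < (L : ℝ) ^ 2 := by positivity
  set N : ℕ := 2 * ⌊(1 - 3 / 10) * (L : ℝ) ^ 2 / 2⌋₊ with hNdef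
  have hx0 : (0 : ℝ) ≤ (1 - 3 / 10) * (L : ℝ) ^ 2 / 2 := by positivity
  have hNle : (N : ℝ) ≤ 7 / 10 * (L : ℝ) ^ 2 := by
    have h := Nat.floor_le hx0
    rw [hNdef]; push_cast; linarith
  have hNge : 7 / 10 * (L : ℝ) ^ 2 - 2 ≤ N := by
    have h := Nat.lt_floor_add_one ((1 - 3 / 10) * (L : ℝ) ^ 2 / 2)
    rw [hNdef]; push_cast; linarith
  -- lower bound on the sector energy: the `min` is `0`
  have hlow := hSB L (7 / 5 * g) g N 0 hg0.le
  have hmin : min 0 (7 / 5 * g * N / 2 - g / (L : ℝ) ^ 2 * N * ((L : ℝ) ^ 2 - N / 2 + 1)) = 0 := by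
    apply min_eq_left
    have h2 : 7 / 5 * g * N / 2 - g / (L : ℝ) ^ 2 * N * ((L : ℝ) ^ 2 - N / 2 + 1) =
        g * N / (2 * (L : ℝ) ^ 2) * (N - 3 / 5 * (L : ℝ) ^ 2 - 2) := by
      field_simp
      ring
    rw [h2]
    apply mul_nonneg (by positivity)
    nlinarith
  rw [hmin] at hlow
  -- upper bounds on the GC ground energy, by cases on μ
  by_cases hμ : g / 20 ≤ μ
  · -- polarised configurations at full filling `N₂ = L²`
    have hup := groundEnergy_gc_le_polarised L (7 / 5 * g) μ g (L ^ 2) le_rfl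
    have hcast : ((L ^ 2 : ℕ) : ℝ) = (L : ℝ) ^ 2 := by push_cast; ring
    rw [hcast] at hup
    have hμ0 : 0 ≤ μ := by linarith [hg0]
    have h1 : g / 100 * (L : ℝ) ^ 2 ≤ μ * (L : ℝ) ^ 2 - μ * N := by
      have h2 : g / 20 * (3 / 10 * (L : ℝ) ^ 2) ≤ μ * ((L : ℝ) ^ 2 - N) :=
        mul_le_mul hμ (by linarith) (by positivity) hμ0
      nlinarith
    generalize (hubbardTorusWith 2 L 0 (7 / 5 * g) μ - ((g / (L : ℝ) ^ 2 : ℝ) : ℂ) •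
        ((pairField sWave L)ᴴ * pairField sWave L)).groundEnergy = E0 at hup ⊢
    generalize (hubbardTorus 2 L 0 (7 / 5 * g) - ((g / (L : ℝ) ^ 2 : ℝ) : ℂ) •
        ((pairField sWave L)ᴴ * pairField sWave L)).minEnergyOn
          (szSector (Λ := FermionTorus 2 L) N 0) = ME at hlow ⊢
    linarith only [hup, h1, hlow]
  · push Not at hμ
    -- η tower with `m = ⌊3L²/20⌋` pairs
    set m : ℕ := ⌊(3 : ℝ) / 20 * (L : ℝ) ^ 2⌋₊ with hmdef
    have hy0 : (0 : ℝ) ≤ 3 / 20 * (L : ℝ) ^ 2 := by positivity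
    have hmle : (m : ℝ) ≤ 3 / 20 * (L : ℝ) ^ 2 := Nat.floor_le hy0
    have hmge : 3 / 20 * (L : ℝ) ^ 2 - 1 ≤ m := by
      have h := Nat.lt_floor_add_one ((3 : ℝ) / 20 * (L : ℝ) ^ 2)
      linarith
    have hm0 : (0 : ℝ) ≤ m := Nat.cast_nonneg m
    have hmL : m ≤ L ^ 2 := by
      have h : (m : ℝ) ≤ ((L ^ 2 : ℕ) : ℝ) := by push_cast; nlinarith
      exact_mod_cast h
    have hup := groundEnergy_gc_le_tower L (7 / 5 * g) μ g m hmL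
    -- the seed gain dominates the pairing cost and the entropy-free gap budget
    have hA : 17 / 10 * g * m ≤ g / (L : ℝ) ^ 2 * (2 * m * ((L : ℝ) ^ 2 - m + 1)) := by
      have h2 : g / (L : ℝ) ^ 2 * (2 * m * ((L : ℝ) ^ 2 - m + 1)) - 17 / 10 * g * m =
          g * m / (L : ℝ) ^ 2 * (3 / 10 * (L : ℝ) ^ 2 - 2 * m + 2) := by
        field_simp
        ring
      have h3 : 0 ≤ g * m / (L : ℝ) ^ 2 * (3 / 10 * (L : ℝ) ^ 2 - 2 * m + 2) :=
        mul_nonneg (by positivity) (by nlinarith)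
      linarith
    have hNm : (N : ℝ) - 2 * m ≤ 2 / 5 * (L : ℝ) ^ 2 + 2 := by linarith
    have hNm0 : 0 ≤ (N : ℝ) - 2 * m := by linarith
    have h4 : g * (3 / 20 * (L : ℝ) ^ 2 - 1) ≤ g * m := mul_le_mul_of_nonneg_left hmge hg0.le
    have h5 : g * 100 ≤ g * (L : ℝ) ^ 2 := mul_le_mul_of_nonneg_left hL2 hg0.le
    have hg20 : (0 : ℝ) ≤ g / 20 := div_nonneg hg0.le (by norm_num)
    generalize (hubbardTorusWith 2 L 0 (7 / 5 * g) μ - ((g / (L : ℝ) ^ 2 : ℝ) : ℂ) •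
        ((pairField sWave L)ᴴ * pairField sWave L)).groundEnergy = E0 at hup ⊢
    generalize (hubbardTorus 2 L 0 (7 / 5 * g) - ((g / (L : ℝ) ^ 2 : ℝ) : ℂ) •
        ((pairField sWave L)ᴴ * pairField sWave L)).minEnergyOn
          (szSector (Λ := FermionTorus 2 L) N 0) = ME at hlow ⊢
    generalize g / (L : ℝ) ^ 2 * (2 * m * ((L : ℝ) ^ 2 - m + 1)) = X at hup hA ⊢
    rcases le_or_gt μ 0 with hμ0 | hμ0
    · have h1 : μ * N - μ * (2 * m) ≤ 0 := by
        have : μ * ((N : ℝ) - 2 * m) ≤ 0 := mul_nonpos_of_nonpos_of_nonneg hμ0 hNm0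
        linarith
      linarith only [hup, hA, h4, h5, h1, hlow, hg0]
    · have h1 : μ * N - μ * (2 * m) ≤ g / 20 * (2 / 5 * (L : ℝ) ^ 2 + 2) := by
        have h2 : μ * ((N : ℝ) - 2 * m) ≤ g / 20 * ((N : ℝ) - 2 * m) :=
          mul_le_mul_of_nonneg_right hμ.le hNm0
        have h3 : g / 20 * ((N : ℝ) - 2 * m) ≤ g / 20 * (2 / 5 * (L : ℝ) ^ 2 + 2) :=
          mul_le_mul_of_nonneg_left hNm hg20
        linarith
      linarith only [hup, hA, h4, h5, h1, hlow, hg0]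

/-- **The thermally NARROWED crux shape (`β ≤ e^{a/U}`, refuter's `CruxNarrow`, written for the atomic s-wave-seeded torus) is
FALSE too**: the β-cap alone does not remove the structural counterexample (only `g ≥ K·U` does). With `a = 100`,
`U = min(U₀, 1/20)`, `g = 5U/7`, `β = 560 log 4/U ≤ (100/U)²/2 ≤ e^{100/U}`, `ε = g/400`: the statement would give the hull
touch within `(g/200)L²` at its `μ`, against the gap `(g/100)L²`. [folklore] -/
theorem stub_notCruxNarrowShapeAtomicSWave :
    (∀ (L : ℕ) [NeZero L] (U g : ℝ) (N : ℕ) (M : ℝ), 0 ≤ g →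
      min 0 (U * N / 2 - g / (L : ℝ) ^ 2 * N * ((L : ℝ) ^ 2 - N / 2 + 1)) ≤
        (hubbardTorus 2 L 0 U - ((g / (L : ℝ) ^ 2 : ℝ) : ℂ) •
          ((pairField sWave L)ᴴ * pairField sWave L)).minEnergyOn (szSector (Λ := FermionTorus 2 L) N M)) →
    ¬ (∀ δ ∈ Set.Icc (1/10 : ℝ) (2/5 : ℝ), ∃ μ₁ μ₂ : ℝ, -4 < μ₁ ∧ μ₁ ≤ μ₂ ∧ μ₂ < 0 ∧
      ∀ a : ℝ, 0 < a → ∃ U₀ : ℝ, 0 < U₀ ∧ ∀ U ∈ Set.Ioc (0 : ℝ) U₀, ∀ g ∈ Set.Ioc (0 : ℝ) (1 / 10),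
        ∀ β : ℝ, 1 ≤ β → β ≤ Real.exp (a / U) → ∃ μ ∈ Set.Icc μ₁ μ₂, ∀ ε : ℝ, 0 < ε → ∃ L₀ : ℕ,
          ∀ (L : ℕ) [NeZero L], L₀ ≤ L →
            ((hubbardTorus 2 L 0 U - ((g / (L : ℝ) ^ 2 : ℝ) : ℂ) •
              ((pairField sWave L)ᴴ * pairField sWave L)).minEnergyOn
                (szSector (Λ := FermionTorus 2 L) (2 * ⌊(1 - δ) * (L : ℝ) ^ 2 / 2⌋₊) 0) / (L : ℝ) ^ 2) +
              (Real.log (Matrix.partitionFn β (hubbardTorusWith 2 L 0 U μ - ((g / (L : ℝ) ^ 2 : ℝ) : ℂ) •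
                ((pairField sWave L)ᴴ * pairField sWave L))).re / (β * (L : ℝ) ^ 2)) -
              μ * ((2 * ⌊(1 - δ) * (L : ℝ) ^ 2 / 2⌋₊) : ℝ) / (L : ℝ) ^ 2 ≤ Real.log 4 / β + ε) := by
  intro hSB h
  obtain ⟨μ₁, μ₂, -, -, -, hA⟩ := h (3 / 10) ⟨by norm_num, by norm_num⟩
  obtain ⟨U₀, hU₀, hU⟩ := hA 100 (by norm_num)
  -- parameters
  set U : ℝ := min U₀ (1 / 20) with hUdef
  have hU0 : 0 < U := lt_min hU₀ (by norm_num)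
  have hUU₀ : U ≤ U₀ := min_le_left _ _
  have hU20 : U ≤ 1 / 20 := min_le_right _ _
  set g : ℝ := 5 * U / 7 with hgdef
  have hg0 : 0 < g := by positivity
  have hg10 : g ≤ 1 / 10 := by rw [hgdef]; linarith
  have hUg : 7 / 5 * g = U := by rw [hgdef]; ring
  have hlog4 : 0 < Real.log 4 := Real.log_pos (by norm_num)
  have h2log : Real.log 4 = 2 * Real.log 2 := by
    rw [show (4 : ℝ) = 2 ^ 2 by norm_num, Real.log_pow]; norm_num
  have hlog4le : Real.log 4 ≤ 777 / 560 := by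
    rw [h2log]
    have := Real.log_two_lt_d9
    linarith
  have hlog4ge : 1 ≤ Real.log 4 := by
    rw [h2log]
    have := Real.log_two_gt_d9
    linarith
  set β : ℝ := 560 * Real.log 4 / U with hβdef
  have hβ1 : 1 ≤ β := by
    rw [hβdef, le_div_iff₀ hU0]
    linarith
  have hβexp : β ≤ Real.exp (100 / U) := by
    have h1 : β ≤ 777 / U := by
      rw [hβdef]; exact div_le_div_of_nonneg_right (by linarith) hU0.le
    have h2 : 777 / U ≤ (100 / U) ^ 2 / 2 := by
      rw [div_pow, div_div, div_le_div_iff₀ hU0 (by positivity)]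
      nlinarith
    have h3 : (100 / U) ^ 2 / 2 ≤ Real.exp (100 / U) := by
      have := Real.pow_div_factorial_le_exp (100 / U) (by positivity) 2
      simpa [Nat.factorial] using this
    linarith
  obtain ⟨μ, -, hμ⟩ := hU U ⟨hU0, hUU₀⟩ g ⟨hg0, hg10⟩ β hβ1 hβexp
  obtain ⟨L₁, hL₁⟩ := hμ (g / 400) (by positivity)
  haveI hNZ : NeZero (max L₁ 10) := ⟨by positivity⟩
  have hT := hL₁ (max L₁ 10) (le_max_left _ _)
  have hgap := gap_at_of_sectorBound hSB hg0 hg10 μ (max L₁ 10) (le_max_right _ _)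
  rw [hUg] at hgap
  -- abbreviate
  have hZ := exp_neg_mul_groundEnergy_le_partitionFn (isHermitian_HsGc (max L₁ 10) U μ g) β
  have hLr1 : (1 : ℝ) ≤ (((max L₁ 10 : ℕ)) : ℝ) := by exact_mod_cast le_trans (by norm_num) (le_max_right _ _)
  generalize (((max L₁ 10 : ℕ)) : ℝ) = Lr at hT hgap hZ hLr1
  have hLpos : (0 : ℝ) < Lr ^ 2 := by positivity
  have hβpos : 0 < β := lt_of_lt_of_le one_pos hβ1
  generalize (hubbardTorusWith 2 (max L₁ 10) 0 U μ -
      ((g / Lr ^ 2 : ℝ) : ℂ) • ((pairField sWave (max L₁ 10))ᴴ * pairField sWave (max L₁ 10))) = Hgc at hT hgap hZ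
  generalize (hubbardTorus 2 (max L₁ 10) 0 U - ((g / Lr ^ 2 : ℝ) : ℂ) •
      ((pairField sWave (max L₁ 10))ᴴ * pairField sWave (max L₁ 10))).minEnergyOn
        (szSector (Λ := FermionTorus 2 (max L₁ 10)) (2 * ⌊(1 - 3 / 10) * Lr ^ 2 / 2⌋₊) 0) = ME at hT hgap
  push_cast at hgap
  generalize ((⌊(1 - 3 / 10) * Lr ^ 2 / 2⌋₊ : ℕ) : ℝ) = nr at hT hgap
  -- `log Re Z ≥ −β E₀`
  have hlogZ : -(β * Hgc.groundEnergy) ≤ Real.log (Hgc.partitionFn β).re := by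
    calc -(β * Hgc.groundEnergy) = Real.log (Real.exp (-(β * Hgc.groundEnergy))) := (Real.log_exp _).symm
      _ ≤ Real.log (Hgc.partitionFn β).re := Real.log_le_log (Real.exp_pos _) hZ
  have hp : -(Hgc.groundEnergy / Lr ^ 2) ≤ Real.log (Hgc.partitionFn β).re / (β * Lr ^ 2) := by
    rw [le_div_iff₀ (mul_pos hβpos hLpos)]
    have : -(Hgc.groundEnergy / Lr ^ 2) * (β * Lr ^ 2) = -(β * Hgc.groundEnergy) := by
      field_simp
    linarith
  -- the allowance `log 4/β = U/560 = g/400`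
  have hslack : Real.log 4 / β = g / 400 := by
    rw [hβdef, hgdef]
    field_simp
    ring
  rw [hslack] at hT
  have h1 : ME / Lr ^ 2 - Hgc.groundEnergy / Lr ^ 2 - μ * (2 * nr) / Lr ^ 2 ≤ g / 400 + g / 400 := by
    linarith
  have h2 : (ME - Hgc.groundEnergy - μ * (2 * nr)) / Lr ^ 2 ≤ g / 200 := by
    rw [sub_div, sub_div]; linarith
  rw [div_le_iff₀ hLpos] at h2
  nlinarith

end

end Summit.HubbardSuperconductivity.HubbardSuperconductivity.Theorems.TwSeededEnsembleEquivalence.ExposedDensity
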